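import Summits.NavierStokesRegularity.NavierStokesRegularity.Theses.AxisymmetricExtremality
import Literature.Analysis.FluidPDE.LocalHelmholtzSupBound
import HarnessLib

/-!
# Seregin 2020, proof of Thm 2.1, the no-swirl endgame core: the velocity is bounded by its curl
# and its local `L¹` norm (local Helmholtz sup bound, unit scale)

Helper toward the stub `stub_seregin2020TypeII` of the crux `AxisymmetricKatoGlobal` (= the named
fact `Literature.Analysis.FluidPDE.Seregin2020_axisymmetricSingularPoint_typeII`, G. Seregin,
Anal. Math. Phys. 10 (2020) Paper 46 = arXiv:2006.04140, Thm 2.1), last paragraph of the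
printed proof (arXiv p. 8): once the maximum principle for `η = ω_φ/ϱ` has bounded the vorticity
of the swirl-free blow-up limit near a clean first singular point, "the function `u` is a
continuous function in `Q̄(R)`" — i.e. bounded vorticity plus the energy class give a bounded
velocity. The elliptic mechanism is the local Helmholtz (Biot–Savart) representation at a
point: for a `C²` field `v` which is divergence free on `B̄(x, 2)`,

  `v(x) = (K ∗ curl(φv))(x) + ∑ⱼ (∫ ∂ⱼΓ(x − y) ⟪v(y), ∇φ(y)⟫ dy) eⱼ`,  `φ = suppCutoff x 1`,

(`eq_biotSavart_curl_smul_add_of_divergence_eq_zero`; the tree's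
`eq_biotSavart_curl_smul_add` asks `div v = 0` everywhere, which a localised representative
cannot offer — the proof is the tree's, the divergence entering only through `div(φv)` on the
support of `φ`), and the resulting sup bound

  `‖v(x)‖ ≤ 2Λ + C ∫_{B̄(x,2)} ‖v‖`  whenever `‖curl v‖ ≤ Λ` on `B̄(x, 2)`

(`exists_const_norm_le_of_curl_le_unit`; the tree's `exists_norm_sub_biotSavart_le` with `b = 0`
and the global `L²` norm replaced by the local `L¹` norm: the near field of `φ curl v` costs
`Λ (4π)⁻¹ ∫_{|z|<2} |z|⁻² = 2Λ`, the cut-off terms live on the shell `1 ≤ |x − y| ≤ 2` where all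
kernels are bounded by `(4π)⁻¹`). The scaled and localised forms used at the singular point are
in the sibling file `…NoSwirlCore`.

## References

* G. Seregin, Anal. Math. Phys. 10 (2020), Paper 46 = arXiv:2006.04140, proof of Thm. 2.1, last
  paragraph (arXiv p. 8). [Seregin2020]
* A. J. Majda, A. L. Bertozzi, *Vorticity and Incompressible Flow* (2002), §2.4.1 (2.92)–(2.95)
  (Helmholtz / Biot–Savart representation). [MajdaBertozziCUP2002]
* D. Gilbarg, N. S. Trudinger (2001), (2.17), Lemma 4.1. [GilbargTrudinger2001]
* J. Serrin, Arch. Rational Mech. Anal. 9 (1962) 187–195 (velocity from vorticity, interior).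
  [Serrin1962]
-/

-- the problem directory repeats the summit name (D-0017); core's `dupNamespace` linter fires
set_option linter.dupNamespace false

noncomputable section

open MeasureTheory Set Function Filter Metric Real InnerProductSpace
open _root_.Topology
open scoped ENNReal NNReal RealInnerProductSpace Laplacian ContDiff

namespace Summit.NavierStokesRegularity.NavierStokesRegularity.Theorems.AxisymmetricKatoGlobal.EulerScaling

open Literature.Analysis.FluidPDE

section Representation

variable {v : EuclideanSpace ℝ (Fin 3) → EuclideanSpace ℝ (Fin 3)}

/-- **The local Helmholtz identity at a point, for a field divergence free on `B̄(x, 2)` only.**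
For a `C²` field `v` with `div v = 0` on `B̄(x, 2)` and the smooth cutoff `φ = suppCutoff x 1`
(`= 1` on `B̄(x, 1)`, supported in `B̄(x, 2)`):
`v(x) = (K ∗ curl(φv))(x) + ∑ⱼ (∫ ∂ⱼΓ(x − y) ⟪v(y), ∇φ(y)⟫ dy) eⱼ`. The tree's
`eq_biotSavart_curl_smul_add` verbatim, except that `div(φv) = ⟪v, ∇φ⟫` is checked on and off
the support of `φ` separately. [cite: MajdaBertozziCUP2002, §2.4.1 Prop. 2.16 (2.92)–(2.95)] -/
theorem eq_biotSavart_curl_smul_add_of_divergence_eq_zero (hv : ContDiff ℝ 2 v)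
    {x : EuclideanSpace ℝ (Fin 3)}
    (hdiv : ∀ y ∈ closedBall x 2, VectorCalculus.divergence v y = 0) :
    v x = biotSavart (curl fun y => suppCutoff x 1 y • v y) x +
      ∑ j, (∫ y, fderiv ℝ newtonKernel (x - y) (EuclideanSpace.single (j : Fin 3) (1 : ℝ)) *
        ⟪v y, gradient (suppCutoff x 1) y⟫) • (EuclideanSpace.single (j : Fin 3) (1 : ℝ)) := by
  -- the localised field `W = φ v` and its companions
  set φ : (EuclideanSpace ℝ (Fin 3)) → ℝ := suppCutoff x 1 with hφdef
  have hφ2 : ContDiff ℝ 2 φ := contDiff_suppCutoff' x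
  have hφc : HasCompactSupport φ := hasCompactSupport_suppCutoff x one_pos
  set W : (EuclideanSpace ℝ (Fin 3)) → (EuclideanSpace ℝ (Fin 3)) := fun y => φ y • v y with hWdef
  have hW : ContDiff ℝ 2 W := hφ2.smul hv
  have hWc : HasCompactSupport W := hφc.smul_right
  have hcW : ContDiff ℝ 1 (curl W) := contDiff_curl (n := 1) (by exact hW)
  have hcWc : HasCompactSupport (curl W) := hasCompactSupport_curl hWc
  have hccWc : HasCompactSupport (curl (curl W)) := hasCompactSupport_curl hcWc
  have hccW : Continuous (curl (curl W)) := continuous_curl hcW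
  -- `div W = ⟪v, ∇φ⟫`
  set f : (EuclideanSpace ℝ (Fin 3)) → ℝ := fun y => ⟪v y, gradient φ y⟫ with hfdef
  have hdivW : VectorCalculus.divergence W = f := by
    funext y
    rw [hWdef, divergence_smul_apply (hφ2.differentiable (by norm_num) y)
      (hv.differentiable (by norm_num) y)]
    by_cases hy : ‖y - x‖ ≤ 2
    · rw [hdiv y (by rwa [mem_closedBall, dist_eq_norm]), mul_zero, zero_add]
    · rw [hφdef, suppCutoff_eq_zero one_pos (by linarith [not_le.1 hy]), zero_mul, zero_add]
  have hv1 : ContDiff ℝ 1 v := hv.of_le (by norm_num)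
  have hf1 : ContDiff ℝ 1 f := ContDiff.inner ℝ hv1 (contDiff_gradient_suppCutoff x)
  have hfc : HasCompactSupport f := by
    refine (hasCompactSupport_gradient_suppCutoff x).mono ?_
    intro y hy
    rw [mem_support] at hy ⊢
    intro h
    have h' : gradient φ y = 0 := by rw [hφdef]; exact h
    exact hy (show ⟪v y, gradient φ y⟫ = 0 by rw [h', inner_zero_right])
  -- the Laplacian
  have hΔc : Continuous (Δ W) := (contDiff_laplacian (n := 0) (by exact hW)).continuous
  have hΔs : HasCompactSupport (Δ W) :=
    HasCompactSupport.of_support_subset_isCompact hWc.isCompact fun y hy => by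
      by_contra h
      exact hy (laplacian_eq_zero_of_notMem_tsupport h)
  -- `curl curl W = G − ΔW`, `G = ∑ᵢ ∂ᵢ f eᵢ`
  set G : (EuclideanSpace ℝ (Fin 3)) → (EuclideanSpace ℝ (Fin 3)) := fun y => ∑ i, (fderiv ℝ f y (EuclideanSpace.single (i : Fin 3) (1 : ℝ))) • (EuclideanSpace.single (i : Fin 3) (1 : ℝ)) with hGdef
  have hccW_eq : ∀ y, curl (curl W) y = G y - (Δ W) y := fun y => by
    rw [curl_curl_eq_sum_fderiv_divergence_sub_laplacian hW y, hdivW]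
  -- integrability against `Γ(x − ·)`
  have IΔ : Integrable fun y => newtonKernel (x - y) • (Δ W) y :=
    integrable_newtonKernel_smul hΔc hΔs x
  have Icc : Integrable fun y => newtonKernel (x - y) • curl (curl W) y :=
    integrable_newtonKernel_smul hccW hccWc x
  have IG : Integrable fun y => newtonKernel (x - y) • G y := by
    have h := Icc.add IΔ
    refine h.congr (Eventually.of_forall fun y => ?_)
    show newtonKernel (x - y) • curl (curl W) y + newtonKernel (x - y) • (Δ W) y = _
    rw [hccW_eq, smul_sub, sub_add_cancel]
  have Ii : ∀ i : Fin 3, Integrable fun y => newtonKernel (x - y) * fderiv ℝ f y (EuclideanSpace.single (i : Fin 3) (1 : ℝ)) := fun i => by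
    have h := integrable_newtonKernel_smul (F := ℝ)
      ((hf1.continuous_fderiv one_ne_zero).clm_apply continuous_const)
      (hfc.fderiv_apply (𝕜 := ℝ) (EuclideanSpace.single (i : Fin 3) (1 : ℝ))) x
    simpa only [smul_eq_mul] using h
  -- `∫ Γ • G = ∑ⱼ (∫ ∂ⱼΓ(x − y) f(y)) eⱼ`
  have hG : ∫ y, newtonKernel (x - y) • G y =
      ∑ j, (∫ y, fderiv ℝ newtonKernel (x - y) (EuclideanSpace.single (j : Fin 3) (1 : ℝ)) * f y) • (EuclideanSpace.single (j : Fin 3) (1 : ℝ)) := by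
    have hexp : (fun y => newtonKernel (x - y) • G y) =
        fun y => ∑ j, (newtonKernel (x - y) * fderiv ℝ f y (EuclideanSpace.single (j : Fin 3) (1 : ℝ))) • (EuclideanSpace.single (j : Fin 3) (1 : ℝ)) := by
      funext y
      rw [hGdef, Finset.smul_sum]
      refine Finset.sum_congr rfl fun j _ => ?_
      rw [smul_smul]
    rw [hexp, integral_finsetSum _ fun j _ => (Ii j).smul_const _]
    refine Finset.sum_congr rfl fun j _ => ?_
    rw [integral_smul_const]
    congr 1
    have h := integral_newtonKernel_smul_fderiv_eq (F := ℝ) hf1 hfc x (EuclideanSpace.single (j : Fin 3) (1 : ℝ))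
    simpa only [smul_eq_mul] using h
  -- Green
  have hGreen : ∫ y, newtonKernel (x - y) • (Δ W) y = v x := by
    rw [integral_newtonKernel_smul_laplacian hW hWc x, hWdef]
    simp only [hφdef, suppCutoff_eq_one one_pos (by rw [sub_self, norm_zero]; norm_num : ‖x - x‖ ≤ 1),
      one_smul]
  -- assemble
  have h1 := biotSavart_eq_neg_integral_newtonKernel_smul_curl hcW hcWc x
  have h2 : ∫ y, newtonKernel (x - y) • curl (curl W) y =
      (∫ y, newtonKernel (x - y) • G y) - ∫ y, newtonKernel (x - y) • (Δ W) y := by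
    rw [← integral_sub IG IΔ]
    refine integral_congr_ae (Eventually.of_forall fun y => ?_)
    show newtonKernel (x - y) • curl (curl W) y =
      newtonKernel (x - y) • G y - newtonKernel (x - y) • (Δ W) y
    rw [hccW_eq, smul_sub]
  rw [h1, h2, hGreen, hG]
  abel

end Representation

section SupBound

-- nested operator types
set_option maxSynthPendingDepth 3

/-- **Sup bound for a field by its curl and its local `L¹` norm.** There is an absolute
constant `C ≥ 0` such that every `C²` field `v` with `div v = 0` and `‖curl v‖ ≤ Λ` on `B̄(x, 2)`
satisfies `‖v(x)‖ ≤ 2Λ + C ∫_{B̄(x, 2)} ‖v‖`. Proof: the local Helmholtz identity with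
`curl(φv) = φ curl v + ∇φ × v`; the near field of `φ curl v` is
`≤ Λ(4π)⁻¹∫_{|z|<2}|z|⁻² = 2Λ`, and the two cut-off terms live on the shell `1 ≤ |y − x| ≤ 2`
where the kernels are bounded by `(4π)⁻¹` (the tree's `exists_norm_sub_biotSavart_le` with
`b = 0`, read with the local `L¹` norm). [cite: Serrin1962, §1 (interior estimate of the velocity by the vorticity); MajdaBertozziCUP2002 §2.4.1] -/
theorem exists_const_norm_le_of_curl_le_unit :
    ∃ C : ℝ, 0 ≤ C ∧ ∀ (v : EuclideanSpace ℝ (Fin 3) → EuclideanSpace ℝ (Fin 3))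
      (x : EuclideanSpace ℝ (Fin 3)) (Λ : ℝ), ContDiff ℝ 2 v →
      (∀ y ∈ closedBall x 2, VectorCalculus.divergence v y = 0) →
      (∀ y ∈ closedBall x 2, ‖curl v y‖ ≤ Λ) →
      ‖v x‖ ≤ 2 * Λ + C * ∫ y in closedBall x 2, ‖v y‖ := by
  obtain ⟨B, hB0, hB⟩ := exists_norm_gradient_suppCutoff_le
  refine ⟨4 * ((4 * π)⁻¹ * B), by positivity, ?_⟩
  intro v x Λ hv hdiv hΛ
  have hx2 : x ∈ closedBall x 2 := mem_closedBall_self (by norm_num)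
  have hΛ0 : 0 ≤ Λ := (norm_nonneg _).trans (hΛ x hx2)
  have hv1 : ContDiff ℝ 1 v := hv.of_le (by norm_num)
  have hvc : Continuous v := hv.continuous
  -- the cutoff and the identity
  set φ : (EuclideanSpace ℝ (Fin 3)) → ℝ := suppCutoff x 1 with hφdef
  have hφ1 : ContDiff ℝ 1 φ := contDiff_suppCutoff' x
  have hφc : HasCompactSupport φ := hasCompactSupport_suppCutoff x one_pos
  have hφcont : Continuous φ := hφ1.continuous
  have hgφ : Continuous (gradient φ) := (contDiff_gradient_suppCutoff x).continuous
  have hid := eq_biotSavart_curl_smul_add_of_divergence_eq_zero hv hdiv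
  have ha : Continuous (curl v) := continuous_curl hv1
  -- the two sources
  set s₁ : (EuclideanSpace ℝ (Fin 3)) → (EuclideanSpace ℝ (Fin 3)) := fun y => φ y • curl v y with hs₁
  set s₃ : (EuclideanSpace ℝ (Fin 3)) → (EuclideanSpace ℝ (Fin 3)) := fun y => cross (gradient φ y) (v y) with hs₃
  have hs₁c : Continuous s₁ := hφcont.smul ha
  have hs₃c : Continuous s₃ := by
    show Continuous fun y => crossCLM (gradient φ y) (v y)
    exact crossCLM.continuous₂.comp (hgφ.prodMk hvc)
  have hs₁s : HasCompactSupport s₁ := by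
    show HasCompactSupport (φ • curl v)
    exact hφc.smul_right
  have hs₃s : HasCompactSupport s₃ := by
    refine (hasCompactSupport_gradient_suppCutoff x).mono ?_
    intro y hy
    rw [mem_support] at hy ⊢
    intro h
    apply hy
    show cross (gradient φ y) (v y) = 0
    rw [hφdef, h, ← crossCLM_apply, map_zero, zero_apply]
  -- the curl of the localised field
  have hcurlW : ∀ y, curl (fun y => suppCutoff x 1 y • v y) y = s₁ y + s₃ y := by
    intro y
    rw [curl_smul ((hφ1.differentiable one_ne_zero) y) ((hv1.differentiable one_ne_zero) y),
      fderiv_eq_innerSL_gradient, curlCLM_smulRight_innerSL, hs₁, hs₃]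
  -- integrability of the Biot–Savart integrands
  have I₁ := integrable_biotSavartKernel_sub_apply_of_hasCompactSupport hs₁c hs₁s x
  have I₃ := integrable_biotSavartKernel_sub_apply_of_hasCompactSupport hs₃c hs₃s x
  have he1 : ∀ j : Fin 3, ‖(EuclideanSpace.single (j : Fin 3) (1 : ℝ))‖ = 1 := fun j => by simp
  -- the decomposition of `v x`
  have hdec : v x =
      (∫ y, biotSavartKernel (x - y) (s₁ y)) + (∫ y, biotSavartKernel (x - y) (s₃ y)) +
        ∑ j, (∫ y, fderiv ℝ newtonKernel (x - y) (EuclideanSpace.single (j : Fin 3) (1 : ℝ)) *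
          ⟪v y, gradient (suppCutoff x 1) y⟫) • (EuclideanSpace.single (j : Fin 3) (1 : ℝ)) := by
    have hdiff : biotSavart (curl fun y => suppCutoff x 1 y • v y) x =
        (∫ y, biotSavartKernel (x - y) (s₁ y)) + ∫ y, biotSavartKernel (x - y) (s₃ y) := by
      rw [biotSavart, ← integral_add I₁ I₃]
      refine integral_congr_ae (Eventually.of_forall fun y => ?_)
      show biotSavartKernel (x - y) (curl (fun y => suppCutoff x 1 y • v y) y) =
        biotSavartKernel (x - y) (s₁ y) + biotSavartKernel (x - y) (s₃ y)
      rw [← biotSavartCLM_apply, ← biotSavartCLM_apply, ← biotSavartCLM_apply, hcurlW, map_add]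
    conv_lhs => rw [hid]
    rw [hdiff]
  -- the common shell majorant for the cutoff terms
  set g₃ : (EuclideanSpace ℝ (Fin 3)) → ℝ := fun y => (4 * π)⁻¹ * B * ((closedBall x 2).indicator (fun _ => (1 : ℝ)) y * ‖v y‖)
    with hg₃
  have hg₃i : Integrable g₃ := by
    have h1 : Integrable ((closedBall x 2).indicator fun y => ‖v y‖) := by
      rw [integrable_indicator_iff measurableSet_closedBall]
      exact hvc.norm.continuousOn.integrableOn_compact (isCompact_closedBall x 2)
    refine (h1.const_mul ((4 * π)⁻¹ * B)).congr (Eventually.of_forall fun y => ?_)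
    show (4 * π)⁻¹ * B * (closedBall x 2).indicator (fun y => ‖v y‖) y = g₃ y
    rw [hg₃]
    by_cases hy : y ∈ closedBall x 2
    · simp only [indicator_of_mem hy, one_mul]
    · simp only [indicator_of_notMem hy, zero_mul]
  have hg₃int : ∫ y, g₃ y ≤ (4 * π)⁻¹ * B * ∫ y in closedBall x 2, ‖v y‖ := by
    rw [hg₃, integral_const_mul, ← integral_indicator measurableSet_closedBall]
    refine le_of_eq ?_
    congr 1
    refine integral_congr_ae (Eventually.of_forall fun y => ?_)
    show (closedBall x 2).indicator (fun _ => (1 : ℝ)) y * ‖v y‖ = (closedBall x 2).indicator (fun y => ‖v y‖) y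
    by_cases hy : y ∈ closedBall x 2
    · simp only [indicator_of_mem hy, one_mul]
    · simp only [indicator_of_notMem hy, zero_mul]
  -- pointwise facts on the shell
  have hshell : ∀ y, ‖gradient φ y‖ * (‖x - y‖ ^ 2)⁻¹ ≤
      B * (closedBall x 2).indicator (fun _ => (1 : ℝ)) y := by
    intro y
    by_cases h1 : ‖y - x‖ < 1
    · rw [hφdef, gradient_suppCutoff_eq_zero_of_lt h1, norm_zero, zero_mul]
      exact mul_nonneg hB0 (indicator_nonneg (fun _ _ => zero_le_one) y)
    by_cases h2 : 2 < ‖y - x‖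
    · rw [hφdef, gradient_suppCutoff_eq_zero_of_two_lt h2, norm_zero, zero_mul]
      exact mul_nonneg hB0 (indicator_nonneg (fun _ _ => zero_le_one) y)
    · have hy2 : y ∈ closedBall x 2 := by
        rw [mem_closedBall, dist_eq_norm]; exact not_lt.1 h2
      rw [indicator_of_mem hy2, mul_one]
      have hxy : 1 ≤ ‖x - y‖ := by rw [norm_sub_rev]; exact not_lt.1 h1
      have hinv : (‖x - y‖ ^ 2)⁻¹ ≤ 1 := inv_le_one_of_one_le₀ (by nlinarith)
      calc ‖gradient φ y‖ * (‖x - y‖ ^ 2)⁻¹ ≤ B * 1 :=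
            mul_le_mul (hB x y) hinv (by positivity) hB0
        _ = B := mul_one B
  -- bound 1: the near field of the bounded part
  have hb1 : ‖∫ y, biotSavartKernel (x - y) (s₁ y)‖ ≤ 2 * Λ := by
    have hmaj : Integrable fun y => (4 * π)⁻¹ * Λ * kernelMajorant 2 (x - y) :=
      ((integrable_kernelMajorant 2).comp_sub_left x).const_mul _
    have hpt : ∀ y, ‖biotSavartKernel (x - y) (s₁ y)‖ ≤ (4 * π)⁻¹ * Λ * kernelMajorant 2 (x - y) := by
      intro y
      by_cases hy : ‖y - x‖ < 2
      · have hmem : x - y ∈ ball (0 : (EuclideanSpace ℝ (Fin 3))) 2 := by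
          rw [mem_ball_zero_iff, norm_sub_rev]; exact hy
        rw [kernelMajorant, indicator_of_mem hmem]
        calc ‖biotSavartKernel (x - y) (s₁ y)‖ ≤ (4 * π)⁻¹ * ‖s₁ y‖ * (‖x - y‖ ^ 2)⁻¹ :=
              norm_biotSavartKernel_le _ _
          _ ≤ (4 * π)⁻¹ * Λ * (‖x - y‖ ^ 2)⁻¹ := by
              gcongr
              rw [hs₁, norm_smul, Real.norm_eq_abs]
              have hy2 : y ∈ closedBall x 2 := by
                rw [mem_closedBall, dist_eq_norm]; exact hy.le
              calc |φ y| * ‖curl v y‖ ≤ 1 * Λ :=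
                    mul_le_mul (abs_suppCutoff_le_one x 1 y) (hΛ y hy2) (norm_nonneg _) zero_le_one
                _ = Λ := one_mul Λ
      · have h0 : s₁ y = 0 := by
          rw [hs₁]
          show φ y • curl v y = 0
          rw [hφdef, suppCutoff_eq_zero one_pos (by linarith [not_lt.1 hy]), zero_smul]
        rw [h0, biotSavartKernel_zero_right, norm_zero]
        exact mul_nonneg (by positivity) (kernelMajorant_nonneg _ _)
    refine (norm_integral_le_of_norm_le hmaj (Eventually.of_forall hpt)).trans (le_of_eq ?_)
    rw [integral_const_mul, integral_sub_left_eq_self (kernelMajorant 2) volume x,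
      integral_kernelMajorant zero_le_two]
    field_simp
  -- bound 3: the cutoff term of the curl
  have hb3 : ‖∫ y, biotSavartKernel (x - y) (s₃ y)‖ ≤ (4 * π)⁻¹ * B * ∫ y in closedBall x 2, ‖v y‖ := by
    have hpt : ∀ y, ‖biotSavartKernel (x - y) (s₃ y)‖ ≤ g₃ y := by
      intro y
      calc ‖biotSavartKernel (x - y) (s₃ y)‖ ≤ (4 * π)⁻¹ * ‖s₃ y‖ * (‖x - y‖ ^ 2)⁻¹ :=
            norm_biotSavartKernel_le _ _
        _ ≤ (4 * π)⁻¹ * (‖gradient φ y‖ * ‖v y‖) * (‖x - y‖ ^ 2)⁻¹ := by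
            gcongr
            exact norm_cross_le_mul_norm _ _
        _ = (4 * π)⁻¹ * ((‖gradient φ y‖ * (‖x - y‖ ^ 2)⁻¹) * ‖v y‖) := by ring
        _ ≤ (4 * π)⁻¹ * ((B * (closedBall x 2).indicator (fun _ => (1 : ℝ)) y) * ‖v y‖) :=
            mul_le_mul_of_nonneg_left (mul_le_mul_of_nonneg_right (hshell y) (norm_nonneg _))
              (by positivity)
        _ = g₃ y := by rw [hg₃]; ring
    exact (norm_integral_le_of_norm_le hg₃i (Eventually.of_forall hpt)).trans hg₃int
  -- bound 4: the gradient (pressure-like) term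
  have hb4 : ‖∑ j, (∫ y, fderiv ℝ newtonKernel (x - y) (EuclideanSpace.single (j : Fin 3) (1 : ℝ)) *
      ⟪v y, gradient (suppCutoff x 1) y⟫) • (EuclideanSpace.single (j : Fin 3) (1 : ℝ))‖ ≤
      3 * ((4 * π)⁻¹ * B * ∫ y in closedBall x 2, ‖v y‖) := by
    have hcoef : ∀ j : Fin 3, |∫ y, fderiv ℝ newtonKernel (x - y) (EuclideanSpace.single (j : Fin 3) (1 : ℝ)) *
        ⟪v y, gradient (suppCutoff x 1) y⟫| ≤ (4 * π)⁻¹ * B * ∫ y in closedBall x 2, ‖v y‖ := by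
      intro j
      have hpt : ∀ y, ‖fderiv ℝ newtonKernel (x - y) (EuclideanSpace.single (j : Fin 3) (1 : ℝ)) * ⟪v y, gradient (suppCutoff x 1) y⟫‖ ≤
          g₃ y := by
        intro y
        rw [norm_mul, Real.norm_eq_abs, Real.norm_eq_abs]
        have h1 : |fderiv ℝ newtonKernel (x - y) (EuclideanSpace.single (j : Fin 3) (1 : ℝ))| ≤ (4 * π * ‖x - y‖ ^ 2)⁻¹ := by
          calc |fderiv ℝ newtonKernel (x - y) (EuclideanSpace.single (j : Fin 3) (1 : ℝ))| = ‖fderiv ℝ newtonKernel (x - y) (EuclideanSpace.single (j : Fin 3) (1 : ℝ))‖ :=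
                (Real.norm_eq_abs _).symm
            _ ≤ ‖fderiv ℝ newtonKernel (x - y)‖ * ‖(EuclideanSpace.single (j : Fin 3) (1 : ℝ))‖ := ContinuousLinearMap.le_opNorm _ _
            _ ≤ (4 * π * ‖x - y‖ ^ 2)⁻¹ * 1 := by
                gcongr
                · exact norm_fderiv_newtonKernel_le _
                · rw [he1 j]
            _ = (4 * π * ‖x - y‖ ^ 2)⁻¹ := mul_one _
        have h2 : |⟪v y, gradient (suppCutoff x 1) y⟫| ≤ ‖v y‖ * ‖gradient φ y‖ := by
          rw [hφdef]; exact abs_real_inner_le_norm _ _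
        calc |fderiv ℝ newtonKernel (x - y) (EuclideanSpace.single (j : Fin 3) (1 : ℝ))| * |⟪v y, gradient (suppCutoff x 1) y⟫|
            ≤ (4 * π * ‖x - y‖ ^ 2)⁻¹ * (‖v y‖ * ‖gradient φ y‖) :=
              mul_le_mul h1 h2 (abs_nonneg _) (by positivity)
          _ = (4 * π)⁻¹ * ((‖gradient φ y‖ * (‖x - y‖ ^ 2)⁻¹) * ‖v y‖) := by
              rw [mul_inv]; ring
          _ ≤ (4 * π)⁻¹ * ((B * (closedBall x 2).indicator (fun _ => (1 : ℝ)) y) * ‖v y‖) :=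
              mul_le_mul_of_nonneg_left (mul_le_mul_of_nonneg_right (hshell y) (norm_nonneg _))
                (by positivity)
          _ = g₃ y := by rw [hg₃]; ring
      have h := norm_integral_le_of_norm_le hg₃i (Eventually.of_forall hpt)
      rw [Real.norm_eq_abs] at h
      exact h.trans hg₃int
    calc ‖∑ j, (∫ y, fderiv ℝ newtonKernel (x - y) (EuclideanSpace.single (j : Fin 3) (1 : ℝ)) *
          ⟪v y, gradient (suppCutoff x 1) y⟫) • (EuclideanSpace.single (j : Fin 3) (1 : ℝ))‖
        ≤ ∑ j, ‖(∫ y, fderiv ℝ newtonKernel (x - y) (EuclideanSpace.single (j : Fin 3) (1 : ℝ)) *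
          ⟪v y, gradient (suppCutoff x 1) y⟫) • (EuclideanSpace.single (j : Fin 3) (1 : ℝ))‖ := norm_sum_le _ _
      _ = ∑ j, |∫ y, fderiv ℝ newtonKernel (x - y) (EuclideanSpace.single (j : Fin 3) (1 : ℝ)) * ⟪v y, gradient (suppCutoff x 1) y⟫| := by
          refine Finset.sum_congr rfl fun j _ => ?_
          rw [norm_smul, Real.norm_eq_abs, he1 j, mul_one]
      _ ≤ ∑ _j : Fin 3, (4 * π)⁻¹ * B * ∫ y in closedBall x 2, ‖v y‖ :=
          Finset.sum_le_sum fun j _ => hcoef j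
      _ = 3 * ((4 * π)⁻¹ * B * ∫ y in closedBall x 2, ‖v y‖) := by
          rw [Finset.sum_const, Finset.card_univ, Fintype.card_fin]
          simp
  -- assemble
  rw [hdec]
  have e1 := norm_add_le ((∫ y, biotSavartKernel (x - y) (s₁ y)) + (∫ y, biotSavartKernel (x - y) (s₃ y)))
    (∑ j, (∫ y, fderiv ℝ newtonKernel (x - y) (EuclideanSpace.single (j : Fin 3) (1 : ℝ)) *
      ⟪v y, gradient (suppCutoff x 1) y⟫) • (EuclideanSpace.single (j : Fin 3) (1 : ℝ)))
  have e2 := norm_add_le (∫ y, biotSavartKernel (x - y) (s₁ y)) (∫ y, biotSavartKernel (x - y) (s₃ y))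
  linarith [e1, e2, hb1, hb3, hb4]

end SupBound

end Summit.NavierStokesRegularity.NavierStokesRegularity.Theorems.AxisymmetricKatoGlobal.EulerScaling

end
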